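import Summits.CriticalPhenomena.PercolationContinuityZ3.Theorems.Transplant.SkelPhiCorridorKGYValues
import Summits.CriticalPhenomena.PercolationContinuityZ3.Theorems.Transplant.SkelFrmBParamsCorrKG
import HarnessLib

/-!
# N2 (frames-only node `SamePDropOfSkeletonFrm₁`, OPEN) — (ζ″) ledger, THE K-G CORRIDOR SLOT VALUES INSTANTIATED, SECOND AXIS (N-corridor):
# the inputs of record `(n, ℓ, hs, v, R′, ρ, q, W, tgt) := (n_L, ℓ_L, h_L, v_L, KS0.R′0, M_u + 1, P + qx, 2n_L + Wx, pitchY + centring)` of p5-g16's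
# second-axis closed forms (`Skelφ.kgM₁Y / kgE₁Y / kgWm₂Y / kgWp₂Y / kgM₂Y / kgXY / kgCtr2Y / kgHw2Y / kgNY`, SkelPhiCorridorKGYValues), the N-free rows
# **`Skelφ.KGYRows` DISCHARGED at the values** (`kgYRows_of`, same inputs `EqNumL` + box-slot floor `gFloorKG ≤ g` + split row as the first axis), the run
# length of record `kgNYv := kgNY … kgTgtY`.

Sibling of SkelFrmBParamsCorrKG (first axis); the along unit here is one coarse ROW (`U := n_L + |h_L|` lattice units of the shear coordinate), the pitch is
**`pitchY := (20·K·m)/U` rows** (p5-g16 INBOX 2026-08-23T03:48:18Z (b): `m := modulus n_L h_L v_L v_β`, the fine y-coordinate moves by `s₁·U/m` per row, cell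
pitch `20·K·s₁` fine cells; ℤ-division — the one-row rounding is absorbed by the arrival slack, the READING rows certify the landing), the steering target
`kgTgtY := pitchY + (P + ρ − 1)/2 + (sL + ΔY)/2` centres the arrival box `(N+1)·sL + [X − (P+ρ−1), X]` (`KGYRows.kgYVals_last`, far edge in
`(tgt − sL − ΔY, tgt]` by `kgNY_spec`) at `pitchY ± (sL + ΔY)/2`.
* §1 inputs `kgqY qx := P + qx` (`P := ⌊n_Lℓ_L/U⌋ + 1`; `hq : P ≤ q` free), `kgWY Wx := 2·n_L + Wx` (`hW : 3n ≤ 2W` free), `pitchY`, `kgTgtY`, **`kgNYv`**;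
* §2 **`kgYRows_of`**: `KGYRows n_L ℓ_L h_L v_L kgR kgρ (kgqY qx) (kgWY Wx)` from `EqNumL`, `gFloorKG ≤ g` (`hR₁ : 6R′ + 3ρ + 2 ≤ sL` from `M_L − 1 ≤ sL`,
  `hR₂` from `M_L + 1 ≤ n_L`) and the split row `M_u + 1 + |v_L| ≤ n_L`; `kgNYv_le_div` (`Nat.findGreatest_le`); a non-vacuity `example` at numerals.
builds on p205010 (kernel theorem, internal audit signed; external expert review pending) — nothing in this file uses p205010; NOTHING is claimed about the open
node `SamePDropOfSkeletonFrm₁`.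
Lane `prim-bschramm`, seat `prim-bschramm-stmt` (gen 20); helper file (`--supports stmt-CriticalPhenomena-4575 --as helper`); ledger HOME/prim-bschramm-stmt/FRM-PARAMS.md.
[cite: KozmaNitzan2024, §4 Lemma 12 (pp. 23–25: the target box of a corridor; p. 26 (29): the cell pitch)] [cite: MartineauTassion2017, §4.3 Lemma 4.2 (steering)]
-/

open scoped Classical

noncomputable section

namespace Summit.CriticalPhenomena.PercolationContinuityZ3.Theorems.Transplant

namespace PlanarSkeletonFrm

namespace NegB

open Literature.Probability.Percolation Literature.Probability.LatticeModels SimpleGraph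
open SkelConc (Consts)
open Skelφ (shearUnit kgSL kgSLY kgΔY kgNY kgFarY KGYRows)
open Neg

/-! ## §1 The inputs of record, second axis -/

section InputsY

variable (κ : Consts) {V : Type} [DecidableEq V] [Countable V] {G : SimpleGraph V} [G.LocallyFinite] (Φ : PlanarSkeletonFrm G) (t : V) (p : unitInterval)
  (D : Skelφ.StepI.DataNS V) (g f mk qx Wx : ℕ)

/-- **The across start-extent slot** `q := P + qx`, `P := ⌊n_Lℓ_L/U⌋ + 1`. [this work] -/
def kgqY : ℕ := nL κ Φ t p D g f * ℓL κ Φ t p D g f / shearUnit (nL κ Φ t p D g f) (hL κ Φ t p D g f) + 1 + qx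

/-- **The phase-2 window slot** `W := 2·n_L + Wx`. [this work] -/
def kgWY : ℕ := 2 * nL κ Φ t p D g f + Wx

/-- **The cell pitch along y′ in ROWS**: `(20·K·m)/U`, `m := n_L·v_β − h_L·v_L`. [cite: KozmaNitzan2024, §4 p. 26 (29)] -/
def pitchY : ℤ :=
  (20 * (Neg.K κ : ℤ) * TwoAxis.Para.modulus (nL κ Φ t p D g f) (hL κ Φ t p D g f) (vL κ Φ t p D g f) (vβL κ Φ t p D g f)) /
    (shearUnit (nL κ Φ t p D g f) (hL κ Φ t p D g f) : ℕ)

/-- **The steering target (rows)** `tgt := pitchY + (P + ρ − 1)/2 + (sL + ΔY)/2`. [this work] -/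
def kgTgtY : ℤ :=
  pitchY κ Φ t p D g f + ((((nL κ Φ t p D g f * ℓL κ Φ t p D g f / shearUnit (nL κ Φ t p D g f) (hL κ Φ t p D g f) + 1 : ℕ) : ℤ) + kgρ D - 1) / 2) +
    (kgSLY (nL κ Φ t p D g f) (ℓL κ Φ t p D g f) (hL κ Φ t p D g f) + kgΔY (kgR κ Φ t p D mk) (kgρ D)) / 2

/-- **The run length of record, second axis** `N := kgNY n_L ℓ_L h_L v_L R′ ρ q W tgt`. [this work] -/
def kgNYv : ℕ :=
  kgNY (nL κ Φ t p D g f) (ℓL κ Φ t p D g f) (hL κ Φ t p D g f) (vL κ Φ t p D g f) (kgR κ Φ t p D mk) (kgρ D) (kgqY κ Φ t p D g f qx)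
    (kgWY κ Φ t p D g f Wx) (kgTgtY κ Φ t p D g f mk)

/-- `sLY = sL` (the two files' names for `⌊(nℓ − U + 1)/U⌋`). [folklore] -/
theorem kgSLY_eq_kgSL (n ℓ : ℕ) (hs : ℤ) : kgSLY n ℓ hs = kgSL n ℓ hs := rfl

end InputsY

/-! ## §2 The rows `KGYRows` at the values -/

section RowsY

variable (κ : Consts) {V : Type} [DecidableEq V] [Countable V] {G : SimpleGraph V} [G.LocallyFinite] (Φ : PlanarSkeletonFrm G) (t : V) (p : unitInterval)
  (D : Skelφ.StepI.DataNS V) (g f : ℕ)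

/-- **THE ROWS AT THE VALUES, SECOND AXIS.** [this work] -/
theorem kgYRows_of (mk qx Wx : ℕ) (hN : EqNumL κ Φ t p D g f) (hg : gFloorKG κ Φ t p D mk ≤ g)
    (hρv : ((Mu D : ℕ) : ℤ) + 1 + |vL κ Φ t p D g f| ≤ nL κ Φ t p D g f) :
    KGYRows (nL κ Φ t p D g f) (ℓL κ Φ t p D g f) (hL κ Φ t p D g f) (vL κ Φ t p D g f) (kgR κ Φ t p D mk) (kgρ D) (kgqY κ Φ t p D g f qx)
      (kgWY κ Φ t p D g f Wx) := by
  have H := kgRows_of κ Φ t p D g f mk qx Wx hN hg hρv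
  have hnle := hN.n_le
  have hgML : g ≤ ML κ Φ t p D g := (ML_le_ML κ Φ t p D g).2
  have hsL := ML_sub_one_le_kgSL κ Φ t p D g f hN
  unfold gFloorKG at hg
  refine ⟨H.hn, H.hv, H.hlay, ?_, H.hR₂, H.hρv, H.hρL, ?_, ?_⟩
  · -- hR₁ : 6R′ + 3ρ + 2 ≤ sL
    rw [kgSLY_eq_kgSL]
    unfold kgR kgρ
    have : ((8 * KS0.R'0 κ Φ t p D mk + 3 * Mu D + 6 : ℕ) : ℤ) ≤ ML κ Φ t p D g := by exact_mod_cast hg.trans hgML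
    push_cast at this ⊢
    linarith
  · -- hq : P ≤ q
    unfold kgqY; omega
  · -- hW : 3n ≤ 2W
    unfold kgWY; omega

/-- NON-VACUITY WITNESS of the second-axis row set (lead (g11) 2026-08-23T03:52:56Z standing order): `KGYRows` holds at the sample
`(n, ℓ, hs, v, R′, ρ, q, W) := (40, 60, 3, 5, 2, 3, 60, 60)` (`sL = 54`, `P = 56`). [folklore] -/
example : KGYRows 40 60 3 5 2 3 60 60 := by constructor <;> decide

end RowsY

/-! ## §3 The run length's division bound -/

section RunLengthY

variable (κ : Consts) {V : Type} [DecidableEq V] [Countable V] {G : SimpleGraph V} [G.LocallyFinite] (Φ : PlanarSkeletonFrm G) (t : V) (p : unitInterval)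
  (D : Skelφ.StepI.DataNS V) (g f mk qx Wx : ℕ)

/-- `kgNYv ≤ ⌊tgt⌋₊ / ⌊sL⌋₊`. [folklore] -/
theorem kgNYv_le_div : kgNYv κ Φ t p D g f mk qx Wx ≤
    (kgTgtY κ Φ t p D g f mk).toNat / (kgSLY (nL κ Φ t p D g f) (ℓL κ Φ t p D g f) (hL κ Φ t p D g f)).toNat :=
  Nat.findGreatest_le _

end RunLengthY

end NegB

end PlanarSkeletonFrm

end Summit.CriticalPhenomena.PercolationContinuityZ3.Theorems.Transplant

end
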